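import Literature.Algebra.Homology.PresentationRelatorBounds
import Mathlib.GroupTheory.Subgroup.Centralizer
import Mathlib.GroupTheory.QuotientGroup.Defs
import Mathlib.GroupTheory.Perm.Fin
import Mathlib.LinearAlgebra.Dimension.Constructions
import HarnessLib

/-!
# Ring 2 / AbelianAll — generating vectors over a positive-genus base: the two obstructions (WEIL-2 gen 68)

research route, not a corollary; conditional on HC_CM plus one named minimal statement.
`HC_CM` occurs nowhere in this file; nothing here is a case of the Hodge conjecture.

Fact-free group-theoretic core of the census correction E-g68-1 of the account `TYPES-G68.md`
(pub-hodge-ring2, seat ab-weil-2, gen 68).  A branch datum `(G; g_Y; C₁, …, C_R)` is realised by a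
CONNECTED Galois `G`-cover of a curve of genus `g_Y` iff `G` has a GENERATING VECTOR of that type:
elements `a₁, b₁, …, a_g, b_g, c₁, …, c_R` with `cⱼ ∈ Cⱼ`, `∏ [aᵢ, bᵢ] · ∏ cⱼ = 1`, which GENERATE `G`
(Riemann's existence theorem; Lange–Rodríguez, *Decomposition of Jacobians by Prym varieties*, LNM 2310,
Thm. 3.1.1 / 3.1.4).  The gen-41 habitat census tested, for `g_Y ≥ 1`, only the abelianised relation; the
gen-68 realisability census removes 185 of its 518 `g_Y ≥ 1` eightfold rows, by two obstructions whose
algebraic cores are proved here, plus exhaustive search: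

* **O1 (abelian rank).**  If `G` maps onto the additive group of an `𝔽_p`-vector space `V` by a map killing
  the branch elements `cⱼ`, the `2 g_Y` handle elements generate `V`, so `dim V ≤ 2 g_Y`
  (`finrank_le_card_of_surjective_of_closure_union_eq_top`); e.g. a group with a surjection onto `(ℤ/2)³`
  has no generating vector of genus one (`not_generated_by_two_of_two_lt_finrank`,
  `vectorZModTwo_three_not_two_generated`).
* **O2 (genus one).**  For `g_Y = 1` the images of `a, b` in `G/N`, `N` any normal subgroup containing the
  `cⱼ`, generate `G/N` and commute there (`[a,b] = (∏ cⱼ)⁻¹ ∈ N`), so `G/N` is commutative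
  (`quotient_mul_comm_of_genus_one_generating_vector`); e.g. `S₃` has no genus-one generating vector with
  all `cⱼ = 1` (`perm_fin_three_no_commuting_generating_pair`).
-/

namespace Summit.HodgeConjecture.Ring2AbelianAll.GeneratingVectors

open Subgroup

variable {G : Type} [Group G]

/-! ### Generators that are trivial do not matter -/

/-- Adjoining elements equal to `1` does not change the generated subgroup. -/
theorem closure_union_eq_of_subset_one (s t : Set G) (ht : t ⊆ {1}) :
    closure (s ∪ t) = closure s := by
  rw [closure_union, (closure_eq_bot_iff).2 ht, sup_bot_eq]

/-! ### O1: the abelian-rank obstruction -/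

/-- The image of a generating set generates the image: if `φ : G →* M` is surjective and `s` generates `G`,
then `φ '' s` generates `M`. -/
theorem closure_image_eq_top_of_surjective {M : Type} [Group M] (φ : G →* M)
    (hφ : Function.Surjective φ) {s : Set G} (hs : closure s = ⊤) : closure (φ '' s) = ⊤ := by
  rw [← MonoidHom.map_closure, hs, map_top_of_surjective φ hφ]

/-- From a generating set of `Multiplicative V` to an additive generating set of `V`. -/
theorem addClosure_eq_top_of_closure_eq_top {V : Type} [AddCommGroup V] {t : Set (Multiplicative V)}
    (ht : closure t = ⊤) : AddSubgroup.closure (Multiplicative.toAdd '' t) = ⊤ := by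
  rw [eq_top_iff]
  intro v _
  have hv : Multiplicative.ofAdd v ∈ closure t := by rw [ht]; exact mem_top _
  have key : ∀ x ∈ closure t, Multiplicative.toAdd x ∈ AddSubgroup.closure (Multiplicative.toAdd '' t) := by
    intro x hx
    refine closure_induction (p := fun x _ => Multiplicative.toAdd x ∈ AddSubgroup.closure (Multiplicative.toAdd '' t))
      ?_ ?_ ?_ ?_ hx
    · intro y hy
      exact AddSubgroup.subset_closure ⟨y, hy, rfl⟩
    · exact AddSubgroup.zero_mem _
    · intro y z _ _ hy hz
      rw [toAdd_mul]
      exact AddSubgroup.add_mem _ hy hz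
    · intro y _ hy
      rw [toAdd_inv]
      exact AddSubgroup.neg_mem _ hy
  simpa using key _ hv

/-- **O1, basic form.**  If `φ : G →* Multiplicative V` is onto the additive group of a finite-dimensional
`𝔽_p`-vector space `V` and the finset `s` generates `G`, then `dim V ≤ |s|`. -/
theorem finrank_le_card_of_surjective_of_closure_eq_top {p : ℕ} [Fact p.Prime] {V : Type}
    [AddCommGroup V] [Module (ZMod p) V] [Module.Finite (ZMod p) V] [DecidableEq V]
    (φ : G →* Multiplicative V) (hφ : Function.Surjective φ) (s : Finset G)
    (hs : closure (s : Set G) = ⊤) : Module.finrank (ZMod p) V ≤ s.card := by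
  have h1 : closure (φ '' (s : Set G)) = ⊤ := closure_image_eq_top_of_surjective φ hφ hs
  have h2 := addClosure_eq_top_of_closure_eq_top h1
  have himg : Multiplicative.toAdd '' (φ '' (s : Set G)) =
      ((s.image fun g => Multiplicative.toAdd (φ g) : Finset V) : Set V) := by
    rw [Finset.coe_image, Set.image_image]
  rw [himg] at h2
  exact (Literature.Algebra.Homology.RelationModule.finrank_le_card_of_closure_eq_top _ h2).trans
    Finset.card_image_le

/-- **O1, generating-vector form.**  If `φ : G →* Multiplicative V` is onto an `𝔽_p`-space `V`, the finset
`s` (the handle elements `aᵢ, bᵢ`) together with a set `t` of elements KILLED by `φ` (the branch elements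
`cⱼ`, when `φ` factors through `G / ⟨⟨cⱼ⟩⟩`) generates `G`, then `dim V ≤ |s|`; with `|s| = 2 g_Y` this is the
abelian-rank obstruction `d ≤ 2 g_Y` of the realisability census. -/
theorem finrank_le_card_of_surjective_of_closure_union_eq_top {p : ℕ} [Fact p.Prime] {V : Type}
    [AddCommGroup V] [Module (ZMod p) V] [Module.Finite (ZMod p) V] [DecidableEq V]
    (φ : G →* Multiplicative V) (hφ : Function.Surjective φ) (s : Finset G) (t : Set G)
    (ht : ∀ c ∈ t, φ c = 1) (hst : closure ((s : Set G) ∪ t) = ⊤) :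
    Module.finrank (ZMod p) V ≤ s.card := by
  have h1 : closure (φ '' ((s : Set G) ∪ t)) = ⊤ := closure_image_eq_top_of_surjective φ hφ hst
  rw [Set.image_union, closure_union_eq_of_subset_one _ _ (by
    rintro _ ⟨c, hc, rfl⟩
    exact ht c hc)] at h1
  have h2 := addClosure_eq_top_of_closure_eq_top h1
  have himg : Multiplicative.toAdd '' (φ '' (s : Set G)) =
      ((s.image fun g => Multiplicative.toAdd (φ g) : Finset V) : Set V) := by
    rw [Finset.coe_image, Set.image_image]
  rw [himg] at h2
  exact (Literature.Algebra.Homology.RelationModule.finrank_le_card_of_closure_eq_top _ h2).trans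
    Finset.card_image_le

/-- A group mapping onto an `𝔽_p`-space of dimension `> 2` is not generated by two elements (no generating
vector of genus one with branch elements in the kernel: the row type `(60, ℚ(i), g_Y = 1, [x⁴])` of the
account, where `G/⟨x⁴⟩ ≅ ℤ/4 × ℤ/4 × ℤ/2 ↠ (ℤ/2)³`). -/
theorem not_generated_by_two_of_two_lt_finrank {p : ℕ} [Fact p.Prime] {V : Type}
    [AddCommGroup V] [Module (ZMod p) V] [Module.Finite (ZMod p) V] [DecidableEq V] [DecidableEq G]
    (φ : G →* Multiplicative V) (hφ : Function.Surjective φ) (hV : 2 < Module.finrank (ZMod p) V)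
    (a b : G) (t : Set G) (ht : ∀ c ∈ t, φ c = 1) :
    closure (({a, b} : Set G) ∪ t) ≠ ⊤ := by
  intro h
  have hs : (({a, b} : Finset G) : Set G) = ({a, b} : Set G) := by simp
  have key := finrank_le_card_of_surjective_of_closure_union_eq_top (p := p) φ hφ ({a, b} : Finset G) t ht
    (by rw [hs]; exact h)
  have hcard : ({a, b} : Finset G).card ≤ 2 := Finset.card_insert_le a {b} |>.trans (by simp)
  omega

/-- Example: `(ℤ/2)³` itself is not generated by two elements. -/
theorem vectorZModTwo_three_not_two_generated (a b : Multiplicative (Fin 3 → ZMod 2)) :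
    closure ({a, b} : Set (Multiplicative (Fin 3 → ZMod 2))) ≠ ⊤ := by
  classical
  have h := not_generated_by_two_of_two_lt_finrank (p := 2) (V := Fin 3 → ZMod 2)
    (MonoidHom.id (Multiplicative (Fin 3 → ZMod 2))) Function.surjective_id
    (by rw [Module.finrank_fintype_fun_eq_card, Fintype.card_fin]; norm_num) a b ∅ (by simp)
  simpa using h

/-! ### O2: the genus-one obstruction -/

/-- A group generated by a set of pairwise commuting elements is commutative. -/
theorem mul_comm_of_closure_eq_top_of_comm {k : Set G} (hcomm : ∀ x ∈ k, ∀ y ∈ k, x * y = y * x)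
    (hk : closure k = ⊤) (x y : G) : x * y = y * x := by
  have h1 : closure k ≤ centralizer k := by
    rw [closure_le]
    intro z hz
    exact mem_centralizer_iff.2 fun w hw => hcomm w hw z hz
  have hy : y ∈ centralizer k := h1 (by rw [hk]; exact mem_top y)
  have hx : x ∈ centralizer (centralizer k) :=
    closure_le_centralizer_centralizer k (by rw [hk]; exact mem_top x)
  exact ((mem_centralizer_iff.1 hx) y hy).symm

/-- Two commuting generators give a commutative group. -/
theorem mul_comm_of_closure_pair_eq_top {a b : G} (hab : a * b = b * a)
    (h : closure ({a, b} : Set G) = ⊤) (x y : G) : x * y = y * x := by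
  refine mul_comm_of_closure_eq_top_of_comm (k := ({a, b} : Set G)) ?_ h x y
  intro u hu v hv
  simp only [Set.mem_insert_iff, Set.mem_singleton_iff] at hu hv
  rcases hu with rfl | rfl <;> rcases hv with rfl | rfl
  · rfl
  · exact hab
  · exact hab.symm
  · rfl

/-- **O2.**  A genus-one generating vector `(a, b; c₁, …, c_R)` of `G` — `[a,b] · c₁ ⋯ c_R = 1` and
`{a, b} ∪ {cⱼ}` generates — forces `G/N` to be commutative for every normal subgroup `N` containing all
`cⱼ` (take `N` = the normal closure of the branch classes). -/
theorem quotient_mul_comm_of_genus_one_generating_vector (N : Subgroup G) [N.Normal] (a b : G)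
    (cs : List G) (hc : ∀ c ∈ cs, c ∈ N) (hrel : a * b * a⁻¹ * b⁻¹ * cs.prod = 1)
    (hgen : closure (({a, b} : Set G) ∪ {c | c ∈ cs}) = ⊤) (x y : G ⧸ N) : x * y = y * x := by
  let π : G →* G ⧸ N := QuotientGroup.mk' N
  have hprod : π cs.prod = 1 := by
    rw [map_list_prod]
    apply List.prod_eq_one
    intro z hz
    rw [List.mem_map] at hz
    obtain ⟨c, hcm, rfl⟩ := hz
    exact (QuotientGroup.eq_one_iff c).2 (hc c hcm)
  have hab : π a * π b = π b * π a := by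
    have h := congrArg π hrel
    rw [map_mul, hprod, mul_one, map_one, map_mul, map_mul, map_mul, map_inv, map_inv] at h
    -- h : π a * π b * (π a)⁻¹ * (π b)⁻¹ = 1
    have h' : π a * π b * (π a)⁻¹ = π b := by
      calc π a * π b * (π a)⁻¹ = π a * π b * (π a)⁻¹ * (π b)⁻¹ * π b := by group
        _ = π b := by rw [h, one_mul]
    calc π a * π b = π a * π b * (π a)⁻¹ * π a := by group
      _ = π b * π a := by rw [h']
  have himg : closure (π '' (({a, b} : Set G) ∪ {c | c ∈ cs})) = ⊤ :=
    closure_image_eq_top_of_surjective π (QuotientGroup.mk'_surjective N) hgen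
  rw [Set.image_union, closure_union_eq_of_subset_one _ _ (by
    rintro _ ⟨c, hcm, rfl⟩
    exact (QuotientGroup.eq_one_iff c).2 (hc c hcm))] at himg
  have hpair : π '' ({a, b} : Set G) = ({π a, π b} : Set (G ⧸ N)) := by
    rw [Set.image_insert_eq, Set.image_singleton]
  rw [hpair] at himg
  exact mul_comm_of_closure_pair_eq_top hab himg x y

/-- Example: the symmetric group `S₃` (as `Equiv.Perm (Fin 3)`) admits no genus-one generating vector whose
branch elements are all trivial — two commuting permutations never generate it. -/
theorem perm_fin_three_no_commuting_generating_pair (a b : Equiv.Perm (Fin 3)) (hab : a * b = b * a) :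
    closure ({a, b} : Set (Equiv.Perm (Fin 3))) ≠ ⊤ := by
  intro h
  have hcomm := mul_comm_of_closure_pair_eq_top hab h (Equiv.swap 0 1) (Equiv.swap 1 2)
  exact absurd hcomm (by decide)

end Summit.HodgeConjecture.Ring2AbelianAll.GeneratingVectors
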